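import Mathlib
import Summits.AtomisticToContinuum.HydrodynamicLimit.Theorems.ImplosionDichotomyDenseExcursionSonicSmoothBranchCkEuler
import Summits.AtomisticToContinuum.HydrodynamicLimit.Theorems.ImplosionDichotomyDenseExcursionSonicSmoothBranchCkBounds

/-!
# Existence of the smooth branch at a first-kind singular point with a `C^k → C⁰` estimate (variation of parameters)
# (crux `DenseExcursion`, line `sonic-cavity-renewal`, brick for stub `stub_cavityResolventCk`, theorem T2)

Helper file (`--supports stmt-AtomisticToContinuum-12586`, line lead a2, stub-worker W4 for `stub_cavityResolventCk`).
For the `2 × 2` first-kind singular system `x v′ = N(x) v + (τ₁, x τ₂)` on `(−ρ, ρ)`, `ρ ≤ 1`, given a smooth Frobenius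
pair `φ₁ = (a₁, a₂)` (`x φ₁′ = N φ₁`, `a₂(0) = 1`) and `ψ = (ψ₁, ψ₂ = x χ)` (`x ψ′ = (N − ν)ψ`) with Wronskian
`w = a₁ψ₂ − a₂ψ₁` within `1/2` of `−1` and `C^k` bounds `C_b`, VARIATION OF PARAMETERS gives the smooth solution with
prescribed `q(0) = q₀`:
  `v = φ₁·(q₀ + J₁) + ψ·Y`,  `J₁(x) = ∫₀ˣ (χ τ₁ − ψ₁ τ₂)/w`,  `x Y′ = ν Y + G₂`,  `G₂ = (−a₂ τ₁ + x a₁ τ₂)/w`,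
where `Y` is the smooth solution of the scalar Euler equation (`euler_smooth_solution`, the only place where derivatives
are lost: `‖Y‖ ≤ (k/|Im ν| + 1)·sup‖G₂⁽ʲ⁾‖`, `j ≤ k`). With the Leibniz/inverse bounds of `…SonicSmoothBranchCkBounds`
this yields `‖p‖ + ‖q‖ ≤ K(‖q₀‖ + sup_{|y|≤|x|, j≤k}(‖τ₁⁽ʲ⁾‖ + ‖τ₂⁽ʲ⁾‖))` with `K = K(k, C_b, μ)`, `μ ≤ |Im ν|`
(registered helper `singular_branch_exists`). Sources: Coddington–Levinson 1955 Ch. 3 §7, Ch. 4 (folklore).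
-/

noncomputable section

open Set Filter MeasureTheory intervalIntegral
open scoped Topology ContDiff Interval

namespace Summit.AtomisticToContinuum.HydrodynamicLimit.Theorems.SonicCavityRenewal

/-- **Registered helper `singular_branch_exists`: EXISTENCE OF THE SMOOTH BRANCH WITH A `C^k → C⁰` ESTIMATE.** See the
module docstring. [folklore] -/
theorem singular_branch_exists : ∀ (k : ℕ) (Cb μ : ℝ), 0 ≤ Cb → 0 < μ → ∃ K : ℝ, 0 < K ∧ ∀ (ν : ℂ) (ρ : ℝ) (n₁₁ n₁₂ n₂₁ n₂₂ a₁ a₂ ψ₁ ψ₂ χ τ₁ τ₂ : ℝ → ℂ) (q₀ : ℂ), ν.re ≤ (k : ℝ) - 1 → μ ≤ |ν.im| → 0 < ρ → ρ ≤ 1 → ContDiffOn ℝ ∞ a₁ (Set.Ioo (-ρ) ρ) → ContDiffOn ℝ ∞ a₂ (Set.Ioo (-ρ) ρ) → ContDiffOn ℝ ∞ ψ₁ (Set.Ioo (-ρ) ρ) → ContDiffOn ℝ ∞ ψ₂ (Set.Ioo (-ρ) ρ) → ContDiffOn ℝ ∞ χ (Set.Ioo (-ρ) ρ) → a₂ 0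 = 1 → (∀ x ∈ Set.Ioo (-ρ) ρ, ψ₂ x = (x : ℂ) * χ x) → (∀ x ∈ Set.Ioo (-ρ) ρ, (x : ℂ) * deriv a₁ x = n₁₁ x * a₁ x + n₁₂ x * a₂ x ∧ (x : ℂ) * deriv a₂ x = n₂₁ x * a₁ x + n₂₂ x * a₂ x) → (∀ x ∈ Set.Ioo (-ρ) ρ, (x : ℂ) * deriv ψ₁ x = (n₁₁ x - ν) * ψ₁ x + n₁₂ x * ψ₂ x ∧ (x : ℂ) * deriv ψ₂ x = n₂₁ x * ψ₁ x + (n₂₂ x - ν) * ψ₂ x) → (∀ x ∈ Set.Ioo (-ρ) ρ, ‖a₁ x * ψ₂ x - a₂ x * ψ₁ x + 1‖ ≤ 1 / 2) → (∀ i : ℕ, i ≤ k → ∀ x ∈ Set.Ioo (-ρ) ρ, ‖iteratedDeriv i a₁ x‖ ≤ Cb ∧ ‖iteratedDeriv i a₂ x‖ ≤ Cb ∧ ‖iteratedDeriv i ψ₁ x‖ ≤ Cb ∧ ‖iteratedDeriv i ψ₂ x‖ ≤ Cb ∧ ‖iteratedDeriv i χ x‖ ≤ Cb) → ContDiffOn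 ℝ ∞ τ₁ (Set.Ioo (-ρ) ρ) → ContDiffOn ℝ ∞ τ₂ (Set.Ioo (-ρ) ρ) → ∃ p q : ℝ → ℂ, ContDiffOn ℝ ∞ p (Set.Ioo (-ρ) ρ) ∧ ContDiffOn ℝ ∞ q (Set.Ioo (-ρ) ρ) ∧ q 0 = q₀ ∧ (∀ x ∈ Set.Ioo (-ρ) ρ, (x : ℂ) * deriv p x = n₁₁ x * p x + n₁₂ x * q x + τ₁ x ∧ (x : ℂ) * deriv q x = n₂₁ x * p x + n₂₂ x * q x + (x : ℂ) * τ₂ x) ∧ ∀ x ∈ Set.Ioo (-ρ) ρ, ∀ M : ℝ, (∀ y ∈ Set.Icc (-|x|) |x|, ∀ j : ℕ, j ≤ k → ‖iteratedDeriv j τ₁ y‖ ≤ M ∧ ‖iteratedDeriv j τ₂ y‖ ≤ M) → ‖p x‖ + ‖q x‖ ≤ K * (‖q₀‖ + M) := by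
  intro k Cb μ hCb hμ
  -- the uniform constants
  obtain ⟨Dw, hDw⟩ : ∃ Dw : ℝ, Dw = 2 * (2 ^ k * Cb * Cb) := ⟨_, rfl⟩
  have hDw0 : 0 ≤ Dw := by rw [hDw]; positivity
  obtain ⟨Ci, hCi0, hCi⟩ := iteratedDeriv_inv_bound k (1 / 2) Dw (by norm_num) hDw0
  obtain ⟨KG, hKG⟩ : ∃ KG : ℝ, KG = 2 ^ k * (2 ^ k * Cb * Ci) + 2 ^ k * (2 ^ k * (2 ^ k * 1 * Cb) * Ci) := ⟨_, rfl⟩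
  have hKG0 : 0 ≤ KG := by rw [hKG]; positivity
  obtain ⟨K, hK⟩ : ∃ K : ℝ, K = 2 * Cb * (1 + 8 * Cb) + 2 * Cb * ((k / μ + 1) * KG) + 1 := ⟨_, rfl⟩
  have hK0 : 0 < K := by rw [hK]; positivity
  refine ⟨K, hK0, ?_⟩
  intro ν ρ n₁₁ n₁₂ n₂₁ n₂₂ a₁ a₂ ψ₁ ψ₂ χ τ₁ τ₂ q₀ hν hνμ hρ hρ1 ha₁ ha₂ hψ₁ hψ₂ hχ ha₂0 hψχ hodeA hodeΨ hW hbd hτ₁ hτ₂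
  have hνi : ν.im ≠ 0 := fun h => by rw [h, abs_zero] at hνμ; linarith
  set U : Set ℝ := Ioo (-ρ) ρ with hU_def
  have hU : IsOpen U := isOpen_Ioo
  have h0U : (0 : ℝ) ∈ U := ⟨by linarith, hρ⟩
  have hIcc : ∀ {x : ℝ}, x ∈ U → Icc (-|x|) |x| ⊆ U := fun hx y hy =>
    abs_lt.1 (lt_of_le_of_lt (abs_le.2 hy) (abs_lt.2 hx))
  have hdf : ∀ {f : ℝ → ℂ}, ContDiffOn ℝ ∞ f U → ∀ y ∈ U, HasDerivAt f (deriv f y) y :=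
    fun hf y hy => ((hf.differentiableOn (by simp)) y hy |>.differentiableAt (hU.mem_nhds hy)).hasDerivAt
  have hcA : ∀ {f : ℝ → ℂ}, ContDiffOn ℝ ∞ f U → ∀ y ∈ U, ∀ n : ℕ, ContDiffAt ℝ n f y :=
    fun hf y hy n => ((hf y hy).contDiffAt (hU.mem_nhds hy)).of_le (by exact_mod_cast le_top)
  -- the Wronskian and its inverse
  have hw : ∀ x ∈ U, a₁ x * ψ₂ x - a₂ x * ψ₁ x ≠ 0 ∧ (1 / 2 : ℝ) ≤ ‖a₁ x * ψ₂ x - a₂ x * ψ₁ x‖ := by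
    intro x hx
    have h1 : (1 / 2 : ℝ) ≤ ‖a₁ x * ψ₂ x - a₂ x * ψ₁ x‖ := by
      have := norm_sub_norm_le (1 : ℂ) (a₁ x * ψ₂ x - a₂ x * ψ₁ x + 1)
      rw [norm_one, sub_add_cancel_right, norm_neg] at this
      linarith [hW x hx]
    exact ⟨fun h => by rw [h, norm_zero] at h1; linarith, h1⟩
  have hwinv : ∀ x ∈ U, ‖(a₁ x * ψ₂ x - a₂ x * ψ₁ x)⁻¹‖ ≤ 2 := fun x hx => by
    rw [norm_inv]; exact inv_le_of_inv_le₀ (by norm_num) (by rw [inv_eq_one_div]; exact (hw x hx).2)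
  have hwC : ContDiffOn ℝ ∞ (fun x => a₁ x * ψ₂ x - a₂ x * ψ₁ x) U := (ha₁.mul hψ₂).sub (ha₂.mul hψ₁)
  have hwiC : ContDiffOn ℝ ∞ (fun x => (a₁ x * ψ₂ x - a₂ x * ψ₁ x)⁻¹) U := hwC.inv fun x hx => (hw x hx).1
  -- bounds of `C^k` type for the coefficients `α = −a₂/w`, `β = x a₁/w`
  have hbw : ∀ i ≤ k, ∀ x ∈ U, ‖iteratedDeriv i (fun x => a₁ x * ψ₂ x - a₂ x * ψ₁ x) x‖ ≤ Dw := by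
    intro i hi x hx
    have e : (fun x => a₁ x * ψ₂ x - a₂ x * ψ₁ x) = fun x => a₁ x * ψ₂ x + (-(a₂ x)) * ψ₁ x := by funext y; ring
    rw [e, hDw, two_mul]
    refine (norm_iteratedDeriv_add_le ((hcA ha₁ x hx i).mul (hcA hψ₂ x hx i))
      ((hcA ha₂ x hx i).neg.mul (hcA hψ₁ x hx i))).trans (add_le_add ?_ ?_)
    · exact norm_iteratedDeriv_mul_le_of_le' (hcA ha₁ x hx k) (hcA hψ₂ x hx k) hCb
        (fun j hj => (hbd j hj x hx).1) (fun j hj => (hbd j hj x hx).2.2.2.1) i hi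
    · refine norm_iteratedDeriv_mul_le_of_le' (hcA ha₂ x hx k).neg (hcA hψ₁ x hx k) hCb
        (fun j hj => ?_) (fun j hj => (hbd j hj x hx).2.2.1) i hi
      rw [iteratedDeriv_fun_neg, norm_neg]; exact (hbd j hj x hx).2.1
  have hbwi : ∀ i ≤ k, ∀ x ∈ U, ‖iteratedDeriv i (fun x => (a₁ x * ψ₂ x - a₂ x * ψ₁ x)⁻¹) x‖ ≤ Ci :=
    hCi _ U hU hwC (fun x hx => (hw x hx).2) hbw
  have hbα : ∀ x ∈ U, ∀ i ≤ k, ‖iteratedDeriv i (fun x => -(a₂ x) * (a₁ x * ψ₂ x - a₂ x * ψ₁ x)⁻¹) x‖ ≤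
      2 ^ k * Cb * Ci := fun x hx =>
    norm_iteratedDeriv_mul_le_of_le' (hcA ha₂ x hx k).neg (hcA hwiC x hx k) hCb
      (fun j hj => by rw [iteratedDeriv_fun_neg, norm_neg]; exact (hbd j hj x hx).2.1) (fun j hj => hbwi j hj x hx)
  have hbβ : ∀ x ∈ U, ∀ i ≤ k, ‖iteratedDeriv i (fun x : ℝ => (x : ℂ) * a₁ x * (a₁ x * ψ₂ x - a₂ x * ψ₁ x)⁻¹) x‖ ≤
      2 ^ k * (2 ^ k * 1 * Cb) * Ci := by
    intro x hx
    have hx1 : |x| ≤ 1 := (abs_lt.2 hx).le.trans hρ1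
    have hoA : ∀ n : ℕ, ContDiffAt ℝ n (fun y : ℝ => (y : ℂ)) x := fun n => contDiff_ofReal'.contDiffAt.of_le
      (by exact_mod_cast le_top)
    exact norm_iteratedDeriv_mul_le_of_le' ((hoA k).mul (hcA ha₁ x hx k)) (hcA hwiC x hx k) (by positivity)
      (norm_iteratedDeriv_mul_le_of_le' (hoA k) (hcA ha₁ x hx k) zero_le_one
        (fun j _ => norm_iteratedDeriv_ofReal_le j hx1) (fun j hj => (hbd j hj x hx).1))
      (fun j hj => hbwi j hj x hx)
  -- the reduced source `G₂ = α τ₁ + β τ₂` and the scalar Euler solution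
  have hGC : ContDiffOn ℝ ∞ (fun x : ℝ => -(a₂ x) * (a₁ x * ψ₂ x - a₂ x * ψ₁ x)⁻¹ * τ₁ x +
      (x : ℂ) * a₁ x * (a₁ x * ψ₂ x - a₂ x * ψ₁ x)⁻¹ * τ₂ x) U :=
    ((ha₂.neg.mul hwiC).mul hτ₁).add (((contDiff_ofReal'.contDiffOn.mul ha₁).mul hwiC).mul hτ₂)
  obtain ⟨Y, hYC, hYode, hYb⟩ := euler_smooth_solution ν k ρ _ hν hνi hρ hρ1 hGC
  -- the regular quadrature `J₁ = ∫₀ˣ (χ τ₁ − ψ₁ τ₂)/w`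
  have hjC : ContDiffOn ℝ ∞ (fun x => (χ x * τ₁ x - ψ₁ x * τ₂ x) * (a₁ x * ψ₂ x - a₂ x * ψ₁ x)⁻¹) U :=
    ((hχ.mul hτ₁).sub (hψ₁.mul hτ₂)).mul hwiC
  have hJ : ∀ x ∈ U, HasDerivAt (fun u => ∫ t in (0 : ℝ)..u, (χ t * τ₁ t - ψ₁ t * τ₂ t) * (a₁ t * ψ₂ t - a₂ t * ψ₁ t)⁻¹)
      ((χ x * τ₁ x - ψ₁ x * τ₂ x) * (a₁ x * ψ₂ x - a₂ x * ψ₁ x)⁻¹) x := by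
    intro x hx
    have hsub : uIcc 0 x ⊆ U := (uIcc_subset_Icc ⟨neg_nonpos.2 (abs_nonneg x), abs_nonneg x⟩
      ⟨neg_abs_le x, le_abs_self x⟩).trans (hIcc hx)
    exact intervalIntegral.integral_hasDerivAt_right ((hjC.continuousOn.mono hsub).intervalIntegrable)
      (hjC.continuousOn.stronglyMeasurableAtFilter hU x hx) ((hjC.continuousOn x hx).continuousAt (hU.mem_nhds hx))
  have hJC : ContDiffOn ℝ ∞ (fun u => ∫ t in (0 : ℝ)..u, (χ t * τ₁ t - ψ₁ t * τ₂ t) * (a₁ t * ψ₂ t - a₂ t * ψ₁ t)⁻¹) U :=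
    (contDiffOn_infty_iff_deriv_of_isOpen hU).2 ⟨fun x hx => (hJ x hx).differentiableAt.differentiableWithinAt,
      hjC.congr fun x hx => (hJ x hx).deriv⟩
  -- THE SOLUTION
  set J : ℝ → ℂ := fun u => ∫ t in (0 : ℝ)..u, (χ t * τ₁ t - ψ₁ t * τ₂ t) * (a₁ t * ψ₂ t - a₂ t * ψ₁ t)⁻¹ with hJ_def
  refine ⟨fun x => a₁ x * (q₀ + J x) + ψ₁ x * Y x, fun x => a₂ x * (q₀ + J x) + ψ₂ x * Y x,
    (ha₁.mul (contDiffOn_const.add hJC)).add (hψ₁.mul hYC), (ha₂.mul (contDiffOn_const.add hJC)).add (hψ₂.mul hYC),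
    ?_, fun x hx => ?_, fun x hx M hM => ?_⟩
  · -- `q(0) = q₀`
    simp only [hJ_def, intervalIntegral.integral_same, add_zero, ha₂0, one_mul, hψχ 0 h0U, Complex.ofReal_zero,
      zero_mul, add_zero]
  · -- the equations: product rule and the algebra of variation of parameters
    have hw0 := (hw x hx).1
    have eA := hodeA x hx; have eΨ := hodeΨ x hx; have eY := hYode x hx; have eχ := hψχ x hx
    have ew : (a₁ x * ψ₂ x - a₂ x * ψ₁ x)⁻¹ * (a₁ x * ψ₂ x - a₂ x * ψ₁ x) = 1 := inv_mul_cancel₀ hw0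
    have hJq : HasDerivAt (fun y => q₀ + J y) ((χ x * τ₁ x - ψ₁ x * τ₂ x) * (a₁ x * ψ₂ x - a₂ x * ψ₁ x)⁻¹) x :=
      (hJ x hx).const_add q₀
    have hp := ((hdf ha₁ x hx).fun_mul hJq).fun_add ((hdf hψ₁ x hx).fun_mul (hdf hYC x hx))
    have hq := ((hdf ha₂ x hx).fun_mul hJq).fun_add ((hdf hψ₂ x hx).fun_mul (hdf hYC x hx))
    rw [hp.deriv, hq.deriv]
    beta_reduce
    constructor
    · linear_combination (q₀ + J x) * eA.1 + Y x * eΨ.1 + ψ₁ x * eY + τ₁ x * ew -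
        (τ₁ x * (a₁ x * ψ₂ x - a₂ x * ψ₁ x)⁻¹ * a₁ x) * eχ
    · linear_combination (q₀ + J x) * eA.2 + Y x * eΨ.2 + ψ₂ x * eY + ((x : ℂ) * τ₂ x) * ew -
        (a₂ x * τ₁ x * (a₁ x * ψ₂ x - a₂ x * ψ₁ x)⁻¹) * eχ
  · -- the estimate
    have hx1 : |x| ≤ 1 := (abs_lt.2 hx).le.trans hρ1
    have h0x : (0 : ℝ) ∈ Icc (-|x|) |x| := ⟨neg_nonpos.2 (abs_nonneg x), abs_nonneg x⟩
    have hM0 : 0 ≤ M := (norm_nonneg _).trans (hM 0 h0x 0 (Nat.zero_le k)).1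
    have hsub : Icc (-|x|) |x| ⊆ U := hIcc hx
    obtain ⟨b₁, b₂, b₃, b₄, b₅⟩ := hbd 0 (Nat.zero_le k) x hx
    simp only [iteratedDeriv_zero] at b₁ b₂ b₃ b₄ b₅
    -- the quadrature: `‖J x‖ ≤ 4 Cb M |x| ≤ 4 Cb M`
    have hJb : ‖J x‖ ≤ 4 * Cb * M := by
      have hb : ∀ t ∈ Ι (0 : ℝ) x, ‖(χ t * τ₁ t - ψ₁ t * τ₂ t) * (a₁ t * ψ₂ t - a₂ t * ψ₁ t)⁻¹‖ ≤ 4 * Cb * M := by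
        intro t ht
        have ht' : t ∈ Icc (-|x|) |x| := by
          rcases le_total 0 x with h | h
          · rw [uIoc_of_le h] at ht; rw [abs_of_nonneg h]; exact ⟨by linarith [ht.1], ht.2⟩
          · rw [uIoc_of_ge h] at ht; rw [abs_of_nonpos h]; exact ⟨by linarith [ht.1], by linarith [ht.2]⟩
        have htU := hsub ht'
        obtain ⟨c₁, -, c₃, -, c₅⟩ := hbd 0 (Nat.zero_le k) t htU
        simp only [iteratedDeriv_zero] at c₁ c₃ c₅
        obtain ⟨m₁, m₂⟩ := hM t ht' 0 (Nat.zero_le k)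
        simp only [iteratedDeriv_zero] at m₁ m₂
        rw [norm_mul]
        calc _ ≤ (Cb * M + Cb * M) * 2 := mul_le_mul ((norm_sub_le _ _).trans (add_le_add
              (by rw [norm_mul]; exact mul_le_mul c₅ m₁ (norm_nonneg _) hCb)
              (by rw [norm_mul]; exact mul_le_mul c₃ m₂ (norm_nonneg _) hCb))) (hwinv t htU) (norm_nonneg _)
              (by positivity)
          _ = 4 * Cb * M := by ring
      calc ‖J x‖ ≤ 4 * Cb * M * |x - 0| := intervalIntegral.norm_integral_le_of_norm_le_const hb
        _ ≤ 4 * Cb * M * 1 := by rw [sub_zero]; gcongr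
        _ = 4 * Cb * M := mul_one _
    -- the Euler part: `‖Y x‖ ≤ (k/μ + 1) K_G M`
    have hGb : ∀ y ∈ Icc (-|x|) |x|, ∀ j : ℕ, j ≤ k →
        ‖iteratedDeriv j (fun x : ℝ => -(a₂ x) * (a₁ x * ψ₂ x - a₂ x * ψ₁ x)⁻¹ * τ₁ x +
          (x : ℂ) * a₁ x * (a₁ x * ψ₂ x - a₂ x * ψ₁ x)⁻¹ * τ₂ x) y‖ ≤ KG * M := by
      intro y hy j hj
      have hyU := hsub hy
      have hαC : ContDiffAt ℝ j (fun x => -(a₂ x) * (a₁ x * ψ₂ x - a₂ x * ψ₁ x)⁻¹) y := hcA (ha₂.neg.mul hwiC) y hyU j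
      have hβC : ContDiffAt ℝ j (fun x : ℝ => (x : ℂ) * a₁ x * (a₁ x * ψ₂ x - a₂ x * ψ₁ x)⁻¹) y :=
        hcA ((contDiff_ofReal'.contDiffOn.mul ha₁).mul hwiC) y hyU j
      rw [hKG, add_mul]
      refine (norm_iteratedDeriv_add_le (hαC.mul (hcA hτ₁ y hyU j)) (hβC.mul (hcA hτ₂ y hyU j))).trans
        (add_le_add ?_ ?_)
      · exact norm_iteratedDeriv_mul_le_of_le' (n := k) (hcA (ha₂.neg.mul hwiC) y hyU k) (hcA hτ₁ y hyU k)
          (by positivity) (hbα y hyU) (fun i hi => (hM y hy i hi).1) j hj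
      · exact norm_iteratedDeriv_mul_le_of_le' (n := k) (hcA ((contDiff_ofReal'.contDiffOn.mul ha₁).mul hwiC) y hyU k)
          (hcA hτ₂ y hyU k) (by positivity) (hbβ y hyU) (fun i hi => (hM y hy i hi).2) j hj
    have hYx : ‖Y x‖ ≤ (k / μ + 1) * (KG * M) := by
      refine (hYb x hx (KG * M) hGb).trans (mul_le_mul_of_nonneg_right ?_ (by positivity))
      gcongr
    -- assembling
    calc ‖a₁ x * (q₀ + J x) + ψ₁ x * Y x‖ + ‖a₂ x * (q₀ + J x) + ψ₂ x * Y x‖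
        ≤ (‖a₁ x‖ * (‖q₀‖ + ‖J x‖) + ‖ψ₁ x‖ * ‖Y x‖) + (‖a₂ x‖ * (‖q₀‖ + ‖J x‖) + ‖ψ₂ x‖ * ‖Y x‖) := by
          gcongr <;> refine (norm_add_le _ _).trans (add_le_add ?_ (by rw [norm_mul])) <;> rw [norm_mul] <;>
            exact mul_le_mul_of_nonneg_left (norm_add_le _ _) (norm_nonneg _)
      _ ≤ (Cb * (‖q₀‖ + 4 * Cb * M) + Cb * ((k / μ + 1) * (KG * M))) +
          (Cb * (‖q₀‖ + 4 * Cb * M) + Cb * ((k / μ + 1) * (KG * M))) := by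
          gcongr
      _ ≤ K * (‖q₀‖ + M) := by
          rw [hK]
          have h1 : 0 ≤ Cb * ‖q₀‖ := by positivity
          have h2 : 0 ≤ Cb * M := by positivity
          have h3 : 0 ≤ (k / μ + 1) * KG := by positivity
          nlinarith [norm_nonneg q₀, mul_nonneg h3 (mul_nonneg hCb (norm_nonneg q₀))]

end Summit.AtomisticToContinuum.HydrodynamicLimit.Theorems.SonicCavityRenewal

end
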